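import Literature.Computability.Cryptography.LubyRackoffIdeal
import Literature.Computability.Cryptography.HCoefficient
import HarnessLib

/-!
# The Luby–Rackoff construction, III: proof of the main lemma (Goldreich's Prop. 3.7.8)

Topic `Literature/Computability/Cryptography`; this file DISCHARGES the named fact
`LubyRackoff.MainLemma` of `LubyRackoffIdeal.lean` (`theorem LubyRackoff.MainLemma_holds`): for every
deterministic oracle algorithm `M` with round budget `k` (hence at most `k` queries), input `x` and
output event `S`,
`|Pr_H[M^{DES³_H}(x) ∈ S] − Pr_σ[M^σ(x) ∈ S]| ≤ 2k²/2ⁿ`,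
where `DES³_H` is the three-round Feistel cascade over independent uniformly random round functions
`Hᵢ : {0,1}ⁿ → {0,1}ⁿ` and `σ` a uniformly random permutation of `{0,1}²ⁿ` (O. Goldreich,
*Foundations of Cryptography I*, Prop. 3.7.8 with eq. (3.17), pp. 203–205 of the held 2004 printing;
M. Luby, C. Rackoff 1988).

**The printed argument** (pp. 204–205). Writing the `i`-th query as `(L⁰ᵢ, R⁰ᵢ)` and
`(Lᵏ⁺¹ᵢ, Rᵏ⁺¹ᵢ) = (Rᵏᵢ, Lᵏᵢ ⊕ H⁽ᵏ⁺¹⁾(Rᵏᵢ))`, the bad event `ζ_m` is a collision `Rᵏᵢ = Rᵏⱼ`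
(`i < j`, `k ∈ {1, 2}`); Claim 3.7.8.1: conditioned on `¬ζ_m` the answers `(L³ᵢ, R³ᵢ) = (R²ᵢ, R³ᵢ)`
are values of the random functions `H⁽²⁾, H⁽³⁾` at distinct arguments; Claim 3.7.8.2:
`Pr[ζ_{m+1} | ¬ζ_m] ≤ 2m/2ⁿ` (if `R⁰ᵢ = R⁰_{m+1}` then `R¹ᵢ ≠ R¹_{m+1}` certainly, otherwise
`Pr[R¹ᵢ = R¹_{m+1}] = 2⁻ⁿ`); hence `Pr[ζ_m] < m²/2ⁿ` and the statistical difference to `K_{2n}` is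
`< 2m²/2ⁿ`.

**The formalisation** renders this through the tree's two information-theoretic toolkits, by the
triangle inequality through the uniformly random FUNCTION `h` on `{0,1}²ⁿ`:

* (a) `|Pr_H − Pr_h| ≤ k(k−1)/2ⁿ + k(k−1)/(2·2ⁿ)` (`abs_finProb_feistel_sub_function_le`) by
  Patarin's coefficient-H bound `OracleAlg.hcoeff_abs_le` (`HCoefficient.lean`) with GOOD transcripts =
  "answers at distinct well-formed queries have pairwise distinct left halves" (`LubyRackoff.Good`,
  the complement of a collision among the `R² = L³`):
  - RATIO (Claim 3.7.8.1 as a count, `core_ratio`, `hratio_feistel`): for a good transcript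
    `(v ↦ g v)_{v ∈ Q}`, `#{(f₁,f₂,f₃) : DES³ ↾ Q = g ↾ Q} ≥ #{f₁ : v ↦ R¹(v) injective on Q} ·
    (|F|/2^{n|Q|})²` (the round equations `f₂(R¹ᵥ) = R⁰ᵥ ⊕ L³ᵥ`, `f₃(L³ᵥ) = R¹ᵥ ⊕ R³ᵥ` pin `f₂`,
    `f₃` at `|Q|` distinct points each — cylinder count `card_filter_pins_mul`), and all but a
    `|Q|(|Q|−1)/2ⁿ` fraction of the `f₁` are injective (`card_G1_compl_mul_le`: a pair with equal
    right halves never collides, a pair with distinct right halves collides for exactly `|F|/2ⁿ`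
    functions); consistency with a transcript is such a cylinder condition
    (`consistent_iff_agree`);
  - BAD EVENT (Claim 3.7.8.2, `prF_not_good_le`, `finProb_not_good_le`): by induction on the fuel
    over partial tables (the lazy-sampling lemmas `prF_fresh`, `prF_congr` of
    `PRPSwitchingLemma.lean`), a fresh answer is uniform on `{0,1}²ⁿ` and its left half hits one of
    the `≤ |acc|` earlier left halves with probability `≤ |acc|·2ⁿ/2²ⁿ`; total `≤ k(k−1)/(2·2ⁿ)`.
* (b) `|Pr_h − Pr_σ| ≤ k(k−1)/(2·2²ⁿ)` (`abs_finProb_function_sub_perm_le`): the PRP/PRF switching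
  lemma `abs_prF_sub_prP_le` of `PRPSwitchingLemma.lean` with block length `2n`.
* Total `2k(k−1)/2ⁿ ≤ 2k²/2ⁿ` (`MainLemma_holds`).

Everything here is PROVED; no named facts are introduced.

## Design notes

* Goldreich compares `DES³_{H_n}` with `K_{2n}` directly after the bad event; going through the
  random function and the (already landed) switching lemma is the standard modern route (Patarin's
  Theorem 3 with `Y` = random function) and gives the same printed constant `2m²/2ⁿ`.
* Half blocks are `List.Vector Bool n`; `vx` is the tree's clamped `bxor` on vectors (honest `⊕` on
  equal lengths), `lh`/`rh` the halves of a `2n`-bit block; `table_eq_of` is the only Feistel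
  algebra needed (the round equations imply the prescribed value).
* Decidability instances on `Finset.filter` differ between call sites; `filter_dec_irrel` bridges them.

## References

* O. Goldreich, *Foundations of Cryptography I: Basic Tools*, CUP 2001 [Goldreich2001] (held 2004
  printing, `lit read book:goldreich2004-foundations-cryptography --pages 201-205`): §3.7.2,
  Prop. 3.7.8, Claims 3.7.8.1–2, eq. (3.17)–(3.19) (pp. 203–205); Prop. 3.7.3 (p. 201, switching).
* M. Luby, C. Rackoff, *How to construct pseudorandom permutations from pseudorandom functions*,
  SIAM J. Comput. 17 (1988) 373–386 [LubyRackoff1988] (main lemma; held: CRYPTO '85 abstract).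
* J. Patarin, *The "coefficients H" technique*, SAC 2008, LNCS 5381 (2009) 328–345 [Patarin2009],
  Thm. 3 (p. 329) and App. B (the tool, `HCoefficient.lean`).
-/

namespace Literature.Computability.Cryptography

open _root_.Computability Complexity Finset

namespace LubyRackoff

variable {β : Type} {n : ℕ}

/-- Half blocks `{0,1}ⁿ`. [folklore] -/
abbrev Half (n : ℕ) : Type := List.Vector Bool n
/-- Blocks `{0,1}²ⁿ`. [folklore] -/
abbrev Block (n : ℕ) : Type := List.Vector Bool (2 * n)
/-- Round functions `{0,1}ⁿ → {0,1}ⁿ` (the values of `H_n`). [cite: Goldreich2001, Construction 3.7.6] -/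
abbrev RoundFn (n : ℕ) : Type := Half n → Half n

/-! ### Half-blocks: xor and halves on vectors -/

/-- `vx a b = a ⊕ b` on `{0,1}ⁿ` (the tree's clamped `bxor` lifted to vectors; on equal lengths the
printed bit-by-bit XOR). [cite: Goldreich2001, Construction 3.7.6] -/
def vx (a b : List.Vector Bool n) : List.Vector Bool n :=
  ⟨bxor a.toList b.toList, by rw [length_bxor, a.toList_length]⟩

/-- Unfolding `vx`. [folklore] -/
@[simp] theorem toList_vx (a b : List.Vector Bool n) : (vx a b).toList = bxor a.toList b.toList := rfl

/-- `a ⊕ (a ⊕ b) = b` for the clamped xor on equal lengths. [folklore] -/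
theorem bxor_bxor_cancel_left (a b : List Bool) (h : a.length = b.length) : bxor a (bxor a b) = b := by
  apply List.ext_getElem (by simp [h])
  intro i h₁ h₂
  rw [getElem_bxor, getD_bxor (by simpa using h₁), List.getD_eq_getElem _ _ h₂, ← Bool.xor_assoc, Bool.xor_self,
    Bool.false_xor]

/-- `(a ⊕ b) ⊕ b = a`. [folklore] -/
theorem vx_vx_cancel (a b : List.Vector Bool n) : vx (vx a b) b = a :=
  List.Vector.toList_injective (by simp [bxor_bxor_cancel])

/-- `a ⊕ (a ⊕ b) = b`. [folklore] -/
theorem vx_cancel_left (a b : List.Vector Bool n) : vx a (vx a b) = b :=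
  List.Vector.toList_injective (by
    simp only [toList_vx]
    exact bxor_bxor_cancel_left _ _ (by rw [a.toList_length, b.toList_length]))

/-- `· ⊕ b` is injective. [folklore] -/
theorem vx_left_injective (b : List.Vector Bool n) : Function.Injective fun a => vx a b := fun a a' h => by
  have := congrArg (fun c => vx c b) h
  simpa only [vx_vx_cancel] using this

/-- The left half `w ↾ n` of a `2n`-bit block (`x` in `DES_f(x, y)`). [cite: Goldreich2001, Construction 3.7.6] -/
def lh (w : List.Vector Bool (2 * n)) : List.Vector Bool n :=
  ⟨w.toList.take n, by rw [List.length_take, w.toList_length]; omega⟩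

/-- The right half `w ⇂ n` of a `2n`-bit block (`y` in `DES_f(x, y)`). [cite: Goldreich2001, Construction 3.7.6] -/
def rh (w : List.Vector Bool (2 * n)) : List.Vector Bool n :=
  ⟨w.toList.drop n, by rw [List.length_drop, w.toList_length]; omega⟩

/-- Unfolding `lh`. [folklore] -/
@[simp] theorem toList_lh (w : List.Vector Bool (2 * n)) : (lh w).toList = w.toList.take n := rfl
/-- Unfolding `rh`. [folklore] -/
@[simp] theorem toList_rh (w : List.Vector Bool (2 * n)) : (rh w).toList = w.toList.drop n := rfl

/-- A block is its left half followed by its right half. [folklore] -/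
theorem toList_eq_append (w : List.Vector Bool (2 * n)) : w.toList = (lh w).toList ++ (rh w).toList :=
  (List.take_append_drop n w.toList).symm

/-- Blocks with equal halves are equal. [folklore] -/
theorem eq_of_halves {w w' : List.Vector Bool (2 * n)} (hl : lh w = lh w') (hr : rh w = rh w') : w = w' :=
  List.Vector.toList_injective (by rw [toList_eq_append w, toList_eq_append w', hl, hr])

/-! ### The three rounds on vectors -/

/-- **One Feistel round on vectors**: `DES_f(a, b) = (b, a ⊕ f b)` for the table oracle of `f`.
[cite: Goldreich2001, Construction 3.7.6] -/
theorem feistelRound_apply (f : List.Vector Bool n → List.Vector Bool n) (a b : List.Vector Bool n) :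
    feistelRound n (oracleOfTable f) (a.toList ++ b.toList) = b.toList ++ (vx a (f b)).toList := by
  have ha : a.toList.length = n := a.toList_length
  simp only [feistelRound]
  rw [List.drop_left' ha, List.take_left' ha, oracleOfTable_toList]
  rfl

/-- The round-1 right half `R¹(v) = L⁰ ⊕ f₁(R⁰)` of a query `v = (L⁰, R⁰)`.
[cite: Goldreich2001, Prop. 3.7.8 (proof, p. 204)] -/
def r1 (f₁ : List.Vector Bool n → List.Vector Bool n) (v : List.Vector Bool (2 * n)) : List.Vector Bool n :=
  vx (lh v) (f₁ (rh v))

/-- **`DES³` on vectors**: `DES_{f₁,f₂,f₃}(L⁰, R⁰) = (R², R¹ ⊕ f₃ R²)` with `R¹ = L⁰ ⊕ f₁ R⁰`,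
`R² = R⁰ ⊕ f₂ R¹`. [cite: Goldreich2001, Prop. 3.7.8 (proof, p. 204: `(Lᵏ⁺¹, Rᵏ⁺¹) = (Rᵏ, Lᵏ ⊕ H⁽ᵏ⁺¹⁾(Rᵏ))`)] -/
theorem toList_table_eq (H : RoundTables n) (v : List.Vector Bool (2 * n)) :
    (table H v).toList =
      (vx (rh v) (H.2.1 (r1 H.1 v))).toList ++
        (vx (r1 H.1 v) (H.2.2 (vx (rh v) (H.2.1 (r1 H.1 v))))).toList := by
  rw [toList_table, toList_eq_append v]
  simp only [roundFns, feistel_cons, feistel_nil, feistelRound_apply]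
  rfl

/-- **The round equations pin the value**: if `f₂(R¹ᵥ) = R⁰ᵥ ⊕ L(w)` and `f₃(L(w)) = R¹ᵥ ⊕ R(w)`
then `DES_{f₁,f₂,f₃}(v) = w` (the observation behind Claim 3.7.8.1: given `f₁`, a transcript pins
`f₂` and `f₃` at one point per query). [cite: Goldreich2001, Prop. 3.7.8, Claim 3.7.8.1 (p. 204)] -/
theorem table_eq_of (H : RoundTables n) {v w : List.Vector Bool (2 * n)}
    (h2 : H.2.1 (r1 H.1 v) = vx (rh v) (lh w)) (h3 : H.2.2 (lh w) = vx (r1 H.1 v) (rh w)) :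
    table H v = w := by
  apply List.Vector.toList_injective
  rw [toList_table_eq, h2, vx_cancel_left, h3, vx_cancel_left, ← toList_eq_append]

/-! ### Cylinder sets of functions -/

section Cylinder

variable {ι A B : Type} [DecidableEq ι] [Fintype A] [DecidableEq A] [Fintype B] [DecidableEq B]

omit [DecidableEq ι] in
/-- Fibres of a cylinder over one more (fresh) point all have the size of the smaller cylinder
(`f ↦ f[φ i ↦ ψ i]` is a bijection). [folklore] -/
theorem card_filter_pins_insert (Q : Finset ι) (φ : ι → A) (ψ : ι → B) {i : ι}
    (hfresh : ∀ j ∈ Q, φ j ≠ φ i) (b : B) :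
    (univ.filter fun f : A → B => f (φ i) = b ∧ ∀ j ∈ Q, f (φ j) = ψ j).card =
      (univ.filter fun f : A → B => f (φ i) = ψ i ∧ ∀ j ∈ Q, f (φ j) = ψ j).card := by
  refine Finset.card_nbij' (fun f => Function.update f (φ i) (ψ i)) (fun f => Function.update f (φ i) b)
    (fun f hf => ?_) (fun f hf => ?_) (fun f hf => ?_) (fun f hf => ?_)
  · simp only [coe_filter, mem_univ, true_and, Set.mem_setOf_eq] at hf ⊢
    exact ⟨by simp, fun j hj => by rw [Function.update_of_ne (hfresh j hj)]; exact hf.2 j hj⟩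
  · simp only [coe_filter, mem_univ, true_and, Set.mem_setOf_eq] at hf ⊢
    exact ⟨by simp, fun j hj => by rw [Function.update_of_ne (hfresh j hj)]; exact hf.2 j hj⟩
  · simp only [coe_filter, mem_univ, true_and, Set.mem_setOf_eq] at hf
    change Function.update (Function.update f (φ i) (ψ i)) (φ i) b = f
    rw [Function.update_idem, ← hf.1, Function.update_eq_self]
  · simp only [coe_filter, mem_univ, true_and, Set.mem_setOf_eq] at hf
    change Function.update (Function.update f (φ i) b) (φ i) (ψ i) = f
    rw [Function.update_idem, ← hf.1, Function.update_eq_self]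

/-- **Cylinder count**: prescribing the values of a function at `|Q|` distinct points divides the
number of functions by `|B|^{|Q|}`. [folklore] -/
theorem card_filter_pins_mul (Q : Finset ι) (φ : ι → A) (ψ : ι → B) (hφ : Set.InjOn φ Q) :
    (univ.filter fun f : A → B => ∀ i ∈ Q, f (φ i) = ψ i).card * Fintype.card B ^ Q.card =
      Fintype.card (A → B) := by
  induction Q using Finset.induction_on with
  | empty => simp
  | insert i Q hi ih =>
    have hφQ : Set.InjOn φ Q := hφ.mono (by simp)
    have hfresh : ∀ j ∈ Q, φ j ≠ φ i := fun j hj h =>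
      hi (by rwa [← hφ (mem_insert_of_mem hj) (mem_insert_self i Q) h] )
    -- fibrewise over the value at the fresh point
    have hfib : (univ.filter fun f : A → B => ∀ j ∈ Q, f (φ j) = ψ j).card =
        ∑ b : B, (univ.filter fun f : A → B => f (φ i) = b ∧ ∀ j ∈ Q, f (φ j) = ψ j).card := by
      rw [card_eq_sum_card_fiberwise (f := fun f : A → B => f (φ i)) (t := univ) (fun _ _ => mem_coe.2 (mem_univ _))]
      refine sum_congr rfl fun b _ => ?_
      congr 1
      ext f
      simp only [mem_filter, mem_univ, true_and]
      tauto
    have hins : (univ.filter fun f : A → B => ∀ j ∈ insert i Q, f (φ j) = ψ j) =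
        (univ.filter fun f : A → B => f (φ i) = ψ i ∧ ∀ j ∈ Q, f (φ j) = ψ j) := by
      ext f
      simp only [mem_filter, mem_univ, true_and, forall_mem_insert]
    rw [hins, card_insert_of_notMem hi, pow_succ, ← ih hφQ, hfib,
      sum_congr rfl fun b _ => card_filter_pins_insert Q φ ψ hfresh b, sum_const, card_univ, smul_eq_mul]
    ring

end Cylinder

/-! ### Uniform probabilities as counts -/

/-- Filters along different decidability instances agree. [folklore] -/
theorem filter_dec_irrel {α : Type} (s : Finset α) (p : α → Prop) (i₁ i₂ : DecidablePred p) :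
    @Finset.filter α p i₁ s = @Finset.filter α p i₂ s := by
  have : i₁ = i₂ := Subsingleton.elim _ _
  subst this
  rfl

/-- A uniform probability is a count: `Pr_{θ ← U(Θ)}[E θ] = #{E}/|Θ|`. [folklore] -/
theorem finProb_uniform {Θ : Type} [Fintype Θ] [Nonempty Θ] (E : Θ → Prop) [DecidablePred E] :
    finProb (PMF.uniformOfFintype Θ) E = ((univ.filter E).card : ℝ) / Fintype.card Θ := by
  rw [finProb_eq_sum]
  simp_rw [PMF.uniformOfFintype_apply, ENNReal.toReal_inv, ENNReal.toReal_natCast]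
  rw [← sum_filter, sum_const, nsmul_eq_mul, div_eq_mul_inv]

/-- The outer measure of an event under a `PMF` on a finite type is its `finProb` (bridging the
statement of `MainLemma` to the toolkit of `HCoefficient.lean`). [folklore] -/
theorem toReal_toOuterMeasure_eq_finProb {Θ : Type} [Fintype Θ] (p : PMF Θ) (E : Θ → Prop) :
    (p.toOuterMeasure {θ | E θ}).toReal = finProb p E := by
  classical
  rw [toReal_toOuterMeasure_eq_sum, finProb_eq_sum]
  rfl


/-! ### The coefficient-H count for three Feistel rounds -/

section Count

/-- `|{0,1}ⁿ| = 2ⁿ`. [folklore] -/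
theorem card_half (n : ℕ) : Fintype.card (Half n) = 2 ^ n := by
  rw [card_vector, Fintype.card_bool]

/-- `|{0,1}²ⁿ| = (2ⁿ)²`. [folklore] -/
theorem card_block (n : ℕ) : Fintype.card (Block n) = (2 ^ n) ^ 2 := by
  rw [card_vector, Fintype.card_bool, ← pow_mul, mul_comm]

/-- Solving `a ⊕ b = d` for `b`. [folklore] -/
theorem vx_eq_iff (a b d : Half n) : vx a b = d ↔ b = vx a d := by
  constructor
  · rintro rfl; rw [vx_cancel_left]
  · rintro rfl; rw [vx_cancel_left]

/-- The good first-round functions: `v ↦ R¹(v)` is injective on the queried blocks `Q` (no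
round-1 collision, the `k = 1` half of `¬ζ`). [cite: Goldreich2001, Prop. 3.7.8 (proof, p. 204: `ζ_m`)] -/
noncomputable def G1 (Q : Finset (Block n)) : Finset (RoundFn n) :=
  open scoped Classical in univ.filter fun f₁ => Set.InjOn (r1 f₁) (Q : Set (Block n))

/-- Second-round functions pinned by the transcript given `f₁`: `f₂(R¹ᵥ) = R⁰ᵥ ⊕ L³ᵥ` for `v ∈ Q`.
[cite: Goldreich2001, Prop. 3.7.8, Claim 3.7.8.1 (p. 204)] -/
noncomputable def cyl2 (Q : Finset (Block n)) (g : Block n → Block n) (f₁ : RoundFn n) : Finset (RoundFn n) :=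
  open scoped Classical in univ.filter fun f₂ => ∀ v ∈ Q, f₂ (r1 f₁ v) = vx (rh v) (lh (g v))

/-- Third-round functions pinned by the transcript given `f₁`: `f₃(L³ᵥ) = R¹ᵥ ⊕ R³ᵥ` for `v ∈ Q`.
[cite: Goldreich2001, Prop. 3.7.8, Claim 3.7.8.1 (p. 204)] -/
noncomputable def cyl3 (Q : Finset (Block n)) (g : Block n → Block n) (f₁ : RoundFn n) : Finset (RoundFn n) :=
  open scoped Classical in univ.filter fun f₃ => ∀ v ∈ Q, f₃ (lh (g v)) = vx (r1 f₁ v) (rh (g v))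

/-- The round-function triples consistent with the transcript: Patarin's `H(a, b)` for `DES³`.
[cite: Patarin2009, §2 (p. 329, definition of `H`)] -/
noncomputable def xset (Q : Finset (Block n)) (g : Block n → Block n) : Finset (RoundTables n) :=
  open scoped Classical in univ.filter fun H => ∀ v ∈ Q, table H v = g v

/-- For a good `f₁` the pinned second-round functions are a `2^{-n|Q|}` fraction. [cite: Goldreich2001, Prop. 3.7.8, Claim 3.7.8.1 (eq. (3.19))] -/
theorem card_cyl2_mul {Q : Finset (Block n)} (g : Block n → Block n) {f₁ : RoundFn n} (hf : f₁ ∈ G1 Q) :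
    (cyl2 Q g f₁).card * Fintype.card (Half n) ^ Q.card = Fintype.card (RoundFn n) := by
  classical
  have hinj : Set.InjOn (r1 f₁) Q := (mem_filter.1 hf).2
  have h := card_filter_pins_mul Q (r1 f₁) (fun v => vx (rh v) (lh (g v))) hinj
  unfold cyl2
  convert h

/-- For a good transcript the pinned third-round functions are a `2^{-n|Q|}` fraction. [cite: Goldreich2001, Prop. 3.7.8, Claim 3.7.8.1 (eq. (3.18))] -/
theorem card_cyl3_mul (Q : Finset (Block n)) {g : Block n → Block n} (hg : Set.InjOn (fun v => lh (g v)) Q)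
    (f₁ : RoundFn n) :
    (cyl3 Q g f₁).card * Fintype.card (Half n) ^ Q.card = Fintype.card (RoundFn n) := by
  classical
  have h := card_filter_pins_mul Q (fun v => lh (g v)) (fun v => vx (r1 f₁ v) (rh (g v))) hg
  unfold cyl3
  convert h

/-- The product sets `{f₁ good} × cyl₂(f₁) × cyl₃(f₁)` inject into the consistent triples (the
round equations suffice, `table_eq_of`). [cite: Goldreich2001, Prop. 3.7.8, Claim 3.7.8.1 (p. 204)] -/
theorem sum_card_cyl_le_card_xset (Q : Finset (Block n)) (g : Block n → Block n) :
    ∑ f₁ ∈ G1 Q, (cyl2 Q g f₁).card * (cyl3 Q g f₁).card ≤ (xset Q g).card := by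
  classical
  have hs : ((G1 Q).sigma fun f₁ => cyl2 Q g f₁ ×ˢ cyl3 Q g f₁).card =
      ∑ f₁ ∈ G1 Q, (cyl2 Q g f₁).card * (cyl3 Q g f₁).card := by
    rw [card_sigma]
    exact sum_congr rfl fun f₁ _ => card_product _ _
  rw [← hs]
  refine card_le_card_of_injOn (fun p => (p.1, p.2.1, p.2.2)) (fun p hp => ?_) (fun p _ q _ hpq => ?_)
  · rw [mem_coe, mem_sigma, mem_product] at hp
    obtain ⟨-, h2, h3⟩ := hp
    unfold cyl2 at h2
    unfold cyl3 at h3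
    rw [mem_filter] at h2 h3
    refine mem_coe.2 (mem_filter.2 ⟨mem_univ _, fun v hv => table_eq_of _ (h2.2 v hv) (h3.2 v hv)⟩)
  · obtain ⟨p₁, p₂, p₃⟩ := p
    obtain ⟨q₁, q₂, q₃⟩ := q
    simp only [Prod.mk.injEq] at hpq
    obtain ⟨rfl, rfl, rfl⟩ := hpq
    rfl

/-- **Claim 3.7.8.2, one pair**: two distinct queries with the same right half never collide after
round 1 ("certainly … `R¹ᵢ ≠ R¹_{m+1}`"); with different right halves exactly a `2⁻ⁿ` fraction of the
`f₁` make them collide ("`Pr[H(R⁰ᵢ) ⊕ H(R⁰_{m+1}) = L⁰ᵢ ⊕ L⁰_{m+1}] = 2⁻ⁿ`").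
[cite: Goldreich2001, Prop. 3.7.8, Claim 3.7.8.2 (p. 205, cases 1–2)] -/
theorem card_coll_pair_mul_le (v v' : Block n) (hne : v ≠ v') :
    (univ.filter fun f₁ : RoundFn n => r1 f₁ v = r1 f₁ v').card * Fintype.card (Half n) ≤
      Fintype.card (RoundFn n) := by
  classical
  by_cases hr : rh v = rh v'
  · have h0 : (univ.filter fun f₁ : RoundFn n => r1 f₁ v = r1 f₁ v') = ∅ := by
      refine filter_eq_empty_iff.2 fun f₁ _ h => hne ?_
      unfold r1 at h
      rw [← hr] at h
      exact eq_of_halves (vx_left_injective _ h) hr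
    rw [h0, card_empty, zero_mul]
    exact Nat.zero_le _
  · -- fibrewise over `c = f₁ (rh v)`; each fibre is a two-point cylinder
    set C := (univ.filter fun f₁ : RoundFn n => r1 f₁ v = r1 f₁ v') with hC
    have hfib := card_eq_sum_card_fiberwise (f := fun f₁ : RoundFn n => f₁ (rh v)) (s := C) (t := univ)
      (fun _ _ => mem_coe.2 (mem_univ _))
    have hcyl : ∀ c : Half n, (C.filter fun f₁ : RoundFn n => f₁ (rh v) = c).card * Fintype.card (Half n) ^ 2 =
        Fintype.card (RoundFn n) := by
      intro c
      have h := card_filter_pins_mul (univ : Finset Bool) (fun b => if b then rh v else rh v')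
        (fun b => if b then c else vx (lh v') (vx (lh v) c)) (by
          intro b₁ _ b₂ _ h
          cases b₁ <;> cases b₂ <;> simp_all [eq_comm])
      rw [card_univ, Fintype.card_bool] at h
      rw [← h]
      congr 2
      ext f₁
      simp only [hC, mem_filter, mem_univ, true_and, forall_const, Bool.forall_bool, if_true, if_false,
        Bool.false_eq_true]
      constructor
      · rintro ⟨h1, h2⟩
        refine ⟨?_, h2⟩
        unfold r1 at h1
        rw [h2] at h1
        exact (vx_eq_iff _ _ _).1 h1.symm
      · rintro ⟨h1, h2⟩
        refine ⟨?_, h2⟩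
        unfold r1
        rw [h2, h1, vx_cancel_left]
    have hpos : 0 < Fintype.card (Half n) := Fintype.card_pos
    have key : C.card * Fintype.card (Half n) ^ 2 = Fintype.card (Half n) * Fintype.card (RoundFn n) := by
      rw [hfib, sum_mul, sum_congr rfl fun c _ => hcyl c, sum_const, card_univ, smul_eq_mul]
    have key' : Fintype.card (Half n) * (C.card * Fintype.card (Half n)) =
        Fintype.card (Half n) * Fintype.card (RoundFn n) := by
      rw [← key]; ring
    exact (Nat.eq_of_mul_eq_mul_left hpos key').le

/-- **Union bound over pairs**: at most a `|Q|(|Q|−1)/2ⁿ` fraction of the first-round functions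
produce a round-1 collision on `Q`. [cite: Goldreich2001, Prop. 3.7.8, Claim 3.7.8.2 (p. 205)] -/
theorem card_G1_compl_mul_le (Q : Finset (Block n)) :
    ((G1 Q)ᶜ).card * Fintype.card (Half n) ≤ Q.offDiag.card * Fintype.card (RoundFn n) := by
  classical
  have hsub : (G1 Q)ᶜ ⊆ Q.offDiag.biUnion fun p => univ.filter fun f₁ : RoundFn n => r1 f₁ p.1 = r1 f₁ p.2 := by
    intro f₁ hf
    have h : ¬ Set.InjOn (r1 f₁) (Q : Set (Block n)) := fun hinj =>
      (mem_compl.1 hf) (by unfold G1; exact mem_filter.2 ⟨mem_univ _, hinj⟩)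
    rw [Set.InjOn] at h
    push Not at h
    obtain ⟨a, ha, b, hb, hab, hne⟩ := h
    exact mem_biUnion.2 ⟨(a, b), mem_offDiag.2 ⟨mem_coe.1 ha, mem_coe.1 hb, hne⟩, mem_filter.2 ⟨mem_univ _, hab⟩⟩
  calc ((G1 Q)ᶜ).card * Fintype.card (Half n)
      ≤ (Q.offDiag.biUnion fun p => univ.filter fun f₁ : RoundFn n => r1 f₁ p.1 = r1 f₁ p.2).card *
          Fintype.card (Half n) := Nat.mul_le_mul_right _ (card_le_card hsub)
    _ ≤ (∑ p ∈ Q.offDiag, (univ.filter fun f₁ : RoundFn n => r1 f₁ p.1 = r1 f₁ p.2).card) *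
          Fintype.card (Half n) := Nat.mul_le_mul_right _ card_biUnion_le
    _ = ∑ p ∈ Q.offDiag, (univ.filter fun f₁ : RoundFn n => r1 f₁ p.1 = r1 f₁ p.2).card *
          Fintype.card (Half n) := sum_mul _ _ _
    _ ≤ ∑ _p ∈ Q.offDiag, Fintype.card (RoundFn n) :=
        sum_le_sum fun p hp => card_coll_pair_mul_le p.1 p.2 (mem_offDiag.1 hp).2.2
    _ = Q.offDiag.card * Fintype.card (RoundFn n) := by rw [sum_const, smul_eq_mul]

/-- **The coefficient-H inequality for `DES³` over three random functions** (Claims 3.7.8.1–2 in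
counting form): for a transcript `(v ↦ g v)_{v ∈ Q}` whose answers have pairwise distinct left
halves, `Pr_H[DES³_H ↾ Q = g ↾ Q] ≥ (1 − |Q|(|Q|−1)/2ⁿ) · Pr_h[h ↾ Q = g ↾ Q]`.
[cite: Goldreich2001, Prop. 3.7.8, Claims 3.7.8.1–2 (pp. 204–205)] [cite: Patarin2009, Thm. 3 (p. 329)] -/
theorem core_ratio (Q : Finset (Block n)) (g : Block n → Block n) (hg : Set.InjOn (fun v => lh (g v)) Q) :
    finProb (PMF.uniformOfFintype (Block n → Block n)) (fun h => ∀ v ∈ Q, h v = g v) ≤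
      finProb (PMF.uniformOfFintype (RoundTables n)) (fun H => ∀ v ∈ Q, table H v = g v) +
        ((Q.card : ℝ) * ((Q.card : ℝ) - 1) / 2 ^ n) *
          finProb (PMF.uniformOfFintype (Block n → Block n)) (fun h => ∀ v ∈ Q, h v = g v) := by
  classical
  set P : ℝ := 2 ^ n with hPdef
  set D : ℝ := P ^ Q.card with hDdef
  set e : ℝ := (Q.card : ℝ) * ((Q.card : ℝ) - 1) with hedef
  have hPpos : 0 < P := by rw [hPdef]; positivity
  have hDpos : 0 < D := by rw [hDdef]; positivity
  have hH : (Fintype.card (Half n) : ℝ) = P := by rw [card_half]; push_cast; rw [hPdef]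
  have hB : (Fintype.card (Block n) : ℝ) = P ^ 2 := by rw [card_block]; push_cast; rw [hPdef]
  set cF : ℝ := (Fintype.card (RoundFn n) : ℝ) with hcF
  have hcFpos : 0 < cF := by rw [hcF]; exact_mod_cast Fintype.card_pos
  have hPD : (P ^ 2) ^ Q.card = D ^ 2 := by rw [hDdef]; ring
  -- world `Y`: a cylinder of `|Q|` points among all functions on blocks
  have hY : finProb (PMF.uniformOfFintype (Block n → Block n)) (fun h => ∀ v ∈ Q, h v = g v) = 1 / D ^ 2 := by
    have hG : (0 : ℝ) < Fintype.card (Block n → Block n) := by exact_mod_cast Fintype.card_pos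
    rw [finProb_uniform, ← hPD, ← hB, div_eq_div_iff hG.ne' (by positivity), one_mul]
    have h := card_filter_pins_mul Q (fun v => v) g (fun a _ b _ h => h)
    have h' := congrArg (Nat.cast : ℕ → ℝ) h
    push_cast at h'
    convert h' using 4 <;> first | rfl | exact filter_dec_irrel _ _ _ _
  -- world `X`: at least `|G1| · (cF / D)²` consistent triples
  have h1 : ((G1 Q).card : ℝ) * (cF / D) ^ 2 ≤ (xset Q g).card := by
    have hs' : (∑ f₁ ∈ G1 Q, ((cyl2 Q g f₁).card : ℝ) * (cyl3 Q g f₁).card) ≤ (xset Q g).card := by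
      exact_mod_cast sum_card_cyl_le_card_xset Q g
    have hterm : ∀ f₁ ∈ G1 Q, ((cyl2 Q g f₁).card : ℝ) * (cyl3 Q g f₁).card = (cF / D) ^ 2 := by
      intro f₁ hf
      have h2 : ((cyl2 Q g f₁).card : ℝ) * D = cF := by
        rw [hDdef, ← hH, hcF]; exact_mod_cast card_cyl2_mul g hf
      have h3 : ((cyl3 Q g f₁).card : ℝ) * D = cF := by
        rw [hDdef, ← hH, hcF]; exact_mod_cast card_cyl3_mul Q hg f₁
      rw [(eq_div_iff hDpos.ne').2 h2, (eq_div_iff hDpos.ne').2 h3, sq]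
    rw [sum_congr rfl hterm, sum_const, nsmul_eq_mul] at hs'
    exact hs'
  -- at least `cF (1 − e / P)` good first-round functions
  have h2 : cF * P - e * cF ≤ ((G1 Q).card : ℝ) * P := by
    have hoff : (Q.offDiag.card : ℝ) = e := by
      rw [offDiag_card, Nat.cast_sub (Nat.le_mul_self Q.card), hedef]; push_cast; ring
    have hc : (((G1 Q)ᶜ).card : ℝ) * P ≤ e * cF := by
      rw [← hH, ← hoff, hcF]; exact_mod_cast card_G1_compl_mul_le Q
    have hcc : ((G1 Q).card : ℝ) + ((G1 Q)ᶜ).card = cF := by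
      rw [hcF]; exact_mod_cast Finset.card_add_card_compl (G1 Q)
    have hcc' := congrArg (· * P) hcc
    simp only [add_mul] at hcc'
    linarith
  -- the `X` probability
  have hX : (1 - e / P) / (P ^ 2) ^ Q.card ≤
      finProb (PMF.uniformOfFintype (RoundTables n)) (fun H => ∀ v ∈ Q, table H v = g v) := by
    rw [finProb_uniform, hPD]
    have hR : (Fintype.card (RoundTables n) : ℝ) = cF ^ 3 := by
      rw [hcF, Fintype.card_prod, Fintype.card_prod]; push_cast; ring
    rw [hR]
    calc (1 - e / P) / D ^ 2 = (cF * P - e * cF) / (cF * P * D ^ 2) := by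
          field_simp
      _ ≤ ((G1 Q).card : ℝ) * P / (cF * P * D ^ 2) := div_le_div_of_nonneg_right h2 (by positivity)
      _ = ((G1 Q).card : ℝ) * (cF / D) ^ 2 / cF ^ 3 := by
          field_simp
      _ ≤ ((xset Q g).card : ℝ) / cF ^ 3 := div_le_div_of_nonneg_right h1 (by positivity)
  rw [hY]
  rw [hPD] at hX
  have hsplit : (1 : ℝ) / D ^ 2 = (1 - e / P) / D ^ 2 + e / P * (1 / D ^ 2) := by ring
  linarith

end Count

/-! ### Transcripts: the queried blocks and good transcripts -/

section Transcript

open OracleAlgTranscript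

variable (M : OracleAlg β) (x : List Bool) (n : ℕ)

/-- The well-formed (`2n`-bit) queries asked along the transcript `τ` (the `i`-th query being the
step at the first `i` answers): Patarin's `C₁, …, C_m`. [cite: Patarin2009, App. B (p. 343)] -/
noncomputable def qset (τ : List (List Bool)) : Finset (Block n) :=
  open scoped Classical in univ.filter fun v => ∃ t < τ.length, M.step x (τ.take t) = Sum.inl v.toList

/-- **Good transcripts** (the complement of the round-2 half of `ζ`: the left halves of the answers,
`L³ᵢ = R²ᵢ`, at distinct well-formed queries are pairwise distinct). [cite: Goldreich2001, Prop. 3.7.8 (proof, p. 204: `ζ_m`)] -/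
def Good (τ : List (List Bool)) : Prop :=
  ∀ (i j : ℕ) (vi vj : Block n), i < τ.length → j < τ.length →
    M.step x (τ.take i) = Sum.inl vi.toList → M.step x (τ.take j) = Sum.inl vj.toList → vi ≠ vj →
      (τ.getD i []).take n ≠ (τ.getD j []).take n

/-- Membership in `qset`. [folklore] -/
theorem mem_qset {τ : List (List Bool)} {v : Block n} :
    v ∈ qset M x n τ ↔ ∃ t < τ.length, M.step x (τ.take t) = Sum.inl v.toList := by
  classical
  unfold qset
  rw [mem_filter]
  exact ⟨fun h => h.2, fun h => ⟨mem_univ _, h⟩⟩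

/-- At most one query per round: `|qset τ| ≤ |τ|` ("`M` … asks at most `m` queries").
[cite: Goldreich2001, Prop. 3.7.8 (p. 203)] -/
theorem card_qset_le (τ : List (List Bool)) : (qset M x n τ).card ≤ τ.length := by
  classical
  have hsub : qset M x n τ ⊆ (range τ.length).biUnion fun t =>
      univ.filter fun v : Block n => M.step x (τ.take t) = Sum.inl v.toList := by
    intro v hv
    obtain ⟨t, ht, hst⟩ := (mem_qset M x n).1 hv
    exact mem_biUnion.2 ⟨t, mem_range.2 ht, mem_filter.2 ⟨mem_univ _, hst⟩⟩
  have hone : ∀ t, (univ.filter fun v : Block n => M.step x (τ.take t) = Sum.inl v.toList).card ≤ 1 := by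
    intro t
    refine card_le_one.2 fun a ha b hb => ?_
    rw [mem_filter] at ha hb
    have h := ha.2.symm.trans hb.2
    exact List.Vector.toList_injective (Sum.inl.inj h)
  calc (qset M x n τ).card ≤ _ := card_le_card hsub
    _ ≤ ∑ t ∈ range τ.length, (univ.filter fun v : Block n => M.step x (τ.take t) = Sum.inl v.toList).card :=
        card_biUnion_le
    _ ≤ ∑ _t ∈ range τ.length, 1 := sum_le_sum fun t _ => hone t
    _ = τ.length := by rw [sum_const, card_range, smul_eq_mul, mul_one]

/-- An answer recorded in a transcript, read off the transcript's own oracle. [cite: Patarin2009, App. B (p. 343: "`σᵢ = f(Cᵢ)`")] -/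
theorem getD_answers_eq (h₀ : Block n → Block n) (k : ℕ) {t : ℕ} {v : Block n}
    (ht : t < (M.answers (oracleOfTable h₀) k x).length)
    (hst : M.step x ((M.answers (oracleOfTable h₀) k x).take t) = Sum.inl v.toList) :
    (M.answers (oracleOfTable h₀) k x).getD t [] = (h₀ v).toList := by
  have h := M.consistent_answers (oracleOfTable h₀) k x t v.toList ht hst
  rw [oracleOfTable_toList] at h
  rw [List.getD_eq_getElem?_getD, h, Option.getD_some]

/-- **Consistency with a transcript of the ideal world is a cylinder condition**: an oracle table
`f` is consistent with the transcript of the run against `h₀` iff `f` agrees with `h₀` on the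
well-formed queries of that transcript. [cite: Patarin2009, App. B (p. 343)] -/
theorem consistent_iff_agree (h₀ : Block n → Block n) (k : ℕ) (f : Block n → Block n) :
    M.Consistent x (M.answers (oracleOfTable h₀) k x) (oracleOfTable f) ↔
      ∀ v ∈ qset M x n (M.answers (oracleOfTable h₀) k x), f v = h₀ v := by
  have hc₀ : M.Consistent x (M.answers (oracleOfTable h₀) k x) (oracleOfTable h₀) :=
    M.consistent_answers _ k x
  constructor
  · intro hc v hv
    obtain ⟨t, ht, hst⟩ := (mem_qset M x n).1 hv
    have h1 := hc t v.toList ht hst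
    have h2 := hc₀ t v.toList ht hst
    rw [h1, oracleOfTable_toList, oracleOfTable_toList] at h2
    exact List.Vector.toList_injective (Option.some.inj h2)
  · intro hagree i q hi hst
    rw [hc₀ i q hi hst]
    congr 1
    by_cases hq : q.length = 2 * n
    · have hv : (⟨q, hq⟩ : Block n) ∈ qset M x n (M.answers (oracleOfTable h₀) k x) :=
        (mem_qset M x n).2 ⟨i, hi, hst⟩
      rw [oracleOfTable_apply_of_length_eq _ hq, oracleOfTable_apply_of_length_eq _ hq, hagree _ hv]
    · rw [oracleOfTable_apply_of_length_ne _ hq, oracleOfTable_apply_of_length_ne _ hq]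

/-- For a good transcript of the ideal world, the answers have distinct left halves on the queried
blocks (the hypothesis of `core_ratio`). [cite: Goldreich2001, Prop. 3.7.8 (proof, p. 204)] -/
theorem injOn_of_good (h₀ : Block n → Block n) (k : ℕ) (hgood : Good M x n (M.answers (oracleOfTable h₀) k x)) :
    Set.InjOn (fun v => lh (h₀ v)) (qset M x n (M.answers (oracleOfTable h₀) k x)) := by
  intro v hv w hw hvw
  by_contra hne
  obtain ⟨t, ht, hst⟩ := (mem_qset M x n).1 (mem_coe.1 hv)
  obtain ⟨s, hs, hss⟩ := (mem_qset M x n).1 (mem_coe.1 hw)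
  apply hgood t s v w ht hs hst hss hne
  rw [getD_answers_eq M x n h₀ k ht hst, getD_answers_eq M x n h₀ k hs hss]
  have h := congrArg List.Vector.toList hvw
  simpa only [toList_lh] using h

/-- `d(d−1) ≤ k(k−1)` for `d ≤ k` (real form). [folklore] -/
theorem cast_mul_pred_le {d k : ℕ} (h : d ≤ k) : (d : ℝ) * ((d : ℝ) - 1) ≤ (k : ℝ) * ((k : ℝ) - 1) := by
  rcases h.eq_or_lt with rfl | hlt
  · exact le_rfl
  · have h1 : (d : ℝ) + 1 ≤ k := by exact_mod_cast hlt
    nlinarith [mul_nonneg (sub_nonneg.2 h1) (by positivity : (0 : ℝ) ≤ (k : ℝ) + d),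
      (Nat.cast_nonneg d : (0 : ℝ) ≤ d)]

/-- `0 ≤ k(k−1)` for a natural number `k` (real form). [folklore] -/
theorem cast_mul_pred_nonneg (k : ℕ) : 0 ≤ (k : ℝ) * ((k : ℝ) - 1) := by
  have h := cast_mul_pred_le (Nat.zero_le k)
  simpa using h

/-- **The ratio hypothesis of the coefficient-H bound** for `DES³_{H_n}` against a random function:
for every good ideal transcript, `Pr_h[consistent] ≤ Pr_H[consistent] + (k(k−1)/2ⁿ)·Pr_h[consistent]`.
[cite: Goldreich2001, Prop. 3.7.8, Claim 3.7.8.1 (p. 204)] [cite: Patarin2009, Thm. 3 (p. 329)] -/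
theorem hratio_feistel (k : ℕ) (h₀ : Block n → Block n) (hgood : Good M x n (M.answers (oracleOfTable h₀) k x)) :
    finProb (PMF.uniformOfFintype (Block n → Block n))
        (fun h => M.Consistent x (M.answers (oracleOfTable h₀) k x) (oracleOfTable h)) ≤
      finProb (PMF.uniformOfFintype (RoundTables n))
          (fun H => M.Consistent x (M.answers (oracleOfTable h₀) k x) (oracleOfTable (table H))) +
        ((k : ℝ) * ((k : ℝ) - 1) / 2 ^ n) *
          finProb (PMF.uniformOfFintype (Block n → Block n))
            (fun h => M.Consistent x (M.answers (oracleOfTable h₀) k x) (oracleOfTable h)) := by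
  have hY : finProb (PMF.uniformOfFintype (Block n → Block n))
      (fun h => M.Consistent x (M.answers (oracleOfTable h₀) k x) (oracleOfTable h)) =
      finProb (PMF.uniformOfFintype (Block n → Block n))
        (fun h => ∀ v ∈ qset M x n (M.answers (oracleOfTable h₀) k x), h v = h₀ v) :=
    finProb_congr _ fun h => consistent_iff_agree M x n h₀ k h
  have hX : finProb (PMF.uniformOfFintype (RoundTables n))
      (fun H => M.Consistent x (M.answers (oracleOfTable h₀) k x) (oracleOfTable (table H))) =
      finProb (PMF.uniformOfFintype (RoundTables n))
        (fun H => ∀ v ∈ qset M x n (M.answers (oracleOfTable h₀) k x), table H v = h₀ v) :=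
    finProb_congr _ fun H => consistent_iff_agree M x n h₀ k (table H)
  rw [hY, hX]
  have hcore := core_ratio (qset M x n (M.answers (oracleOfTable h₀) k x)) h₀ (injOn_of_good M x n h₀ k hgood)
  have hd : ((qset M x n (M.answers (oracleOfTable h₀) k x)).card : ℝ) *
      (((qset M x n (M.answers (oracleOfTable h₀) k x)).card : ℝ) - 1) ≤ (k : ℝ) * ((k : ℝ) - 1) :=
    cast_mul_pred_le ((card_qset_le M x n _).trans (M.length_answers_le _ k x))
  have hnn := finProb_nonneg (PMF.uniformOfFintype (Block n → Block n))
    (fun h => ∀ v ∈ qset M x n (M.answers (oracleOfTable h₀) k x), h v = h₀ v)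
  have hmul := mul_le_mul_of_nonneg_right (div_le_div_of_nonneg_right hd (by positivity : (0 : ℝ) ≤ 2 ^ n)) hnn
  linarith

end Transcript

/-! ### The bad event under a random function: lazy sampling -/

section Bad

open OracleAlgTranscript

variable (M : OracleAlg β) (x : List Bool) (n : ℕ)

/-- The lazy-sampling invariant: the partial table records exactly the well-formed queries asked
along `acc`, with their answers. [folklore] -/
def Explains (T : PTable (2 * n)) (acc : List (List Bool)) : Prop :=
  (∀ t < acc.length, ∀ v : Block n, M.step x (acc.take t) = Sum.inl v.toList →
      ∃ y, T v = some y ∧ acc.getD t [] = y.toList) ∧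
    (∀ (v y : Block n), T v = some y →
      ∃ t < acc.length, M.step x (acc.take t) = Sum.inl v.toList ∧ acc.getD t [] = y.toList)

/-- The bad fresh answers: those whose left half already occurs as the left half of an answer to a
well-formed query (a new `R²` collision). [cite: Goldreich2001, Prop. 3.7.8, Claim 3.7.8.2 (p. 205)] -/
noncomputable def badVals (acc : List (List Bool)) : Finset (Block n) :=
  open scoped Classical in univ.filter fun y => ∃ i < acc.length, ∃ vi : Block n,
    M.step x (acc.take i) = Sum.inl vi.toList ∧ (acc.getD i []).take n = y.toList.take n

/-- Prefixes of a one-step extension, below the old length. [folklore] -/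
theorem take_snoc_of_le {acc : List (List Bool)} (a : List Bool) {t : ℕ} (ht : t ≤ acc.length) :
    (acc ++ [a]).take t = acc.take t :=
  List.take_append_of_le_length ht

/-- Entries of a one-step extension, below the old length. [folklore] -/
theorem getD_snoc_of_lt {acc : List (List Bool)} (a : List Bool) {t : ℕ} (ht : t < acc.length) :
    (acc ++ [a]).getD t [] = acc.getD t [] :=
  List.getD_append _ _ _ _ ht

/-- The new entry of a one-step extension. [folklore] -/
theorem getD_snoc_length (acc : List (List Bool)) (a : List Bool) : (acc ++ [a]).getD acc.length [] = a := by
  rw [List.getD_append_right _ _ _ _ le_rfl, Nat.sub_self, List.getD_cons_zero]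

/-- The full old prefix of a one-step extension. [folklore] -/
theorem take_snoc_length (acc : List (List Bool)) (a : List Bool) : (acc ++ [a]).take acc.length = acc := by
  rw [List.take_append_of_le_length le_rfl, List.take_length]

/-- Goodness extends along one more answer whose left half avoids the earlier left halves at
distinct well-formed queries. [folklore] -/
theorem good_snoc {acc : List (List Bool)} {a : List Bool} (hg : Good M x n acc)
    (hnew : ∀ i < acc.length, ∀ vi vj : Block n, M.step x (acc.take i) = Sum.inl vi.toList →
      M.step x acc = Sum.inl vj.toList → vi ≠ vj → (acc.getD i []).take n ≠ a.take n) :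
    Good M x n (acc ++ [a]) := by
  intro i j vi vj hi hj hsi hsj hne
  simp only [List.length_append, List.length_singleton] at hi hj
  rcases Nat.lt_or_ge i acc.length with hi' | hi'
  · rw [take_snoc_of_le a hi'.le] at hsi
    rw [getD_snoc_of_lt a hi']
    rcases Nat.lt_or_ge j acc.length with hj' | hj'
    · rw [take_snoc_of_le a hj'.le] at hsj
      rw [getD_snoc_of_lt a hj']
      exact hg i j vi vj hi' hj' hsi hsj hne
    · obtain rfl : j = acc.length := by omega
      rw [take_snoc_length] at hsj
      rw [getD_snoc_length]
      exact hnew i hi' vi vj hsi hsj hne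
  · obtain rfl : i = acc.length := by omega
    rw [take_snoc_length] at hsi
    rw [getD_snoc_length]
    rcases Nat.lt_or_ge j acc.length with hj' | hj'
    · rw [take_snoc_of_le a hj'.le] at hsj
      rw [getD_snoc_of_lt a hj']
      exact (hnew j hj' vj vi hsj hsi hne.symm).symm
    · obtain rfl : j = acc.length := by omega
      rw [take_snoc_length] at hsj
      rw [hsi] at hsj
      exact absurd (List.Vector.toList_injective (Sum.inl.inj hsj)) hne

/-- The bookkeeping of the partial table along one more answer. [folklore] -/
theorem explains_snoc {T T' : PTable (2 * n)} {acc : List (List Bool)} {a : List Bool}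
    (hE : Explains M x n T acc)
    (hold : ∀ (v y : Block n), T v = some y → T' v = some y)
    (hnewT : ∀ (v y : Block n), T' v = some y → T v = some y ∨ (M.step x acc = Sum.inl v.toList ∧ a = y.toList))
    (hnewpos : ∀ v : Block n, M.step x acc = Sum.inl v.toList → ∃ y, T' v = some y ∧ a = y.toList) :
    Explains M x n T' (acc ++ [a]) := by
  constructor
  · intro t ht v hsv
    simp only [List.length_append, List.length_singleton] at ht
    rcases Nat.lt_or_ge t acc.length with ht' | ht'
    · rw [take_snoc_of_le a ht'.le] at hsv
      rw [getD_snoc_of_lt a ht']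
      obtain ⟨y, hy, hget⟩ := hE.1 t ht' v hsv
      exact ⟨y, hold v y hy, hget⟩
    · obtain rfl : t = acc.length := by omega
      rw [take_snoc_length] at hsv
      rw [getD_snoc_length]
      obtain ⟨y, hy, hay⟩ := hnewpos v hsv
      exact ⟨y, hy, hay⟩
  · intro v y hy
    rcases hnewT v y hy with h | ⟨hsv, hay⟩
    · obtain ⟨t, ht, hst, hget⟩ := hE.2 v y h
      refine ⟨t, by simp only [List.length_append, List.length_singleton]; omega, ?_, ?_⟩
      · rw [take_snoc_of_le a ht.le]; exact hst
      · rw [getD_snoc_of_lt a ht]; exact hget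
    · refine ⟨acc.length, by simp, ?_, ?_⟩
      · rw [take_snoc_length]; exact hsv
      · rw [getD_snoc_length, hay]

/-- At most `|acc|·2ⁿ` fresh answers are bad (each earlier left half has `2ⁿ` completions to a
block). [cite: Goldreich2001, Prop. 3.7.8, Claim 3.7.8.2 (p. 205)] -/
theorem card_badVals_le (acc : List (List Bool)) : (badVals M x n acc).card ≤ acc.length * 2 ^ n := by
  classical
  have hsub : badVals M x n acc ⊆ (range acc.length).biUnion fun i =>
      univ.filter fun y : Block n => y.toList.take n = (acc.getD i []).take n := by
    intro y hy
    unfold badVals at hy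
    obtain ⟨i, hi, vi, -, heq⟩ := (mem_filter.1 hy).2
    exact mem_biUnion.2 ⟨i, mem_range.2 hi, mem_filter.2 ⟨mem_univ _, heq.symm⟩⟩
  have hfib : ∀ c : List Bool, (univ.filter fun y : Block n => y.toList.take n = c).card ≤ 2 ^ n := by
    intro c
    rw [← card_half n, ← Finset.card_univ]
    refine card_le_card_of_injOn (fun y => rh y) (fun _ _ => mem_coe.2 (mem_univ _)) (fun y hy y' hy' h => ?_)
    rw [mem_coe, mem_filter] at hy hy'
    refine eq_of_halves ?_ h
    apply List.Vector.toList_injective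
    rw [toList_lh, toList_lh, hy.2, hy'.2]
  calc (badVals M x n acc).card ≤ _ := card_le_card hsub
    _ ≤ ∑ i ∈ range acc.length, (univ.filter fun y : Block n => y.toList.take n = (acc.getD i []).take n).card :=
        card_biUnion_le
    _ ≤ ∑ _i ∈ range acc.length, 2 ^ n := sum_le_sum fun i _ => hfib _
    _ = acc.length * 2 ^ n := by rw [sum_const, card_range, smul_eq_mul]

/-- **Claim 3.7.8.2 in lazy-sampling form**: against a uniformly random function extending a
partial table that explains the good partial transcript `acc`, the continued run within `k` rounds
produces a bad transcript with probability at most `(k·|acc| + k(k−1)/2)/2ⁿ` (a fresh answer is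
uniform; its left half hits one of the `≤ |acc| + i` earlier left halves with probability
`≤ (|acc| + i)/2ⁿ`). [cite: Goldreich2001, Prop. 3.7.8, Claim 3.7.8.2 (p. 205)] -/
theorem prF_not_good_le :
    ∀ (k : ℕ) (acc : List (List Bool)) (T : PTable (2 * n)), Explains M x n T acc → Good M x n acc →
      prF T (fun h => ¬ Good M x n (M.answersAux (oracleOfTable h) x k acc)) ≤
        ((k : ℝ) * acc.length + (k : ℝ) * ((k : ℝ) - 1) / 2) / 2 ^ n := by
  classical
  intro k
  induction k with
  | zero =>
    intro acc T _ hg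
    have hev : ∀ f : Block n → Block n, (¬ Good M x n (M.answersAux (oracleOfTable f) x 0 acc) ↔ False) :=
      fun f => by simp only [OracleAlg.answersAux, iff_false, not_not]; exact hg
    rw [prF_congr (fun f _ => hev f), prF_const]
    simp
  | succ k ih =>
    intro acc T hE hg
    have hNpos : (0 : ℝ) < 2 ^ n := by positivity
    set IHb : ℝ := ((k : ℝ) * (acc.length + 1) + (k : ℝ) * ((k : ℝ) - 1) / 2) / 2 ^ n with hIHb
    have hIHb_nonneg : 0 ≤ IHb := by
      rw [hIHb]
      apply div_nonneg _ hNpos.le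
      nlinarith [(Nat.cast_nonneg k : (0 : ℝ) ≤ k), (Nat.cast_nonneg acc.length : (0 : ℝ) ≤ acc.length)]
    have hmono : IHb ≤ (((k + 1 : ℕ) : ℝ) * acc.length + ((k + 1 : ℕ) : ℝ) * (((k + 1 : ℕ) : ℝ) - 1) / 2) / 2 ^ n := by
      rw [hIHb]
      apply div_le_div_of_nonneg_right _ hNpos.le
      push_cast
      nlinarith [(Nat.cast_nonneg k : (0 : ℝ) ≤ k), (Nat.cast_nonneg acc.length : (0 : ℝ) ≤ acc.length)]
    have hlen1 : ∀ a : List Bool, ((acc ++ [a]).length : ℝ) = acc.length + 1 := fun a => by simp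
    cases hs : M.step x acc with
    | inr b =>
      have hev : ∀ f : Block n → Block n, (¬ Good M x n (M.answersAux (oracleOfTable f) x (k + 1) acc) ↔ False) :=
        fun f => by rw [answersAux_succ_of_inr hs]; simp only [iff_false, not_not]; exact hg
      rw [prF_congr (fun f _ => hev f), prF_const]
      simp only [if_false]
      exact hIHb_nonneg.trans hmono
    | inl q =>
      by_cases hq : q.length = 2 * n
      · set v : Block n := ⟨q, hq⟩ with hvdef
        have hqv : Sum.inl (α := List Bool) (β := β) q = Sum.inl v.toList := rfl
        cases hTv : T v with
        | some y =>
          -- repeated query: answered by the table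
          have hev : ∀ f : Block n → Block n, T.Extends f →
              (¬ Good M x n (M.answersAux (oracleOfTable f) x (k + 1) acc) ↔
                ¬ Good M x n (M.answersAux (oracleOfTable f) x k (acc ++ [y.toList]))) := fun f hf => by
            rw [answersAux_succ_of_inl hs, oracleOfTable_apply_of_length_eq f hq]
            rw [← hvdef, hf v y hTv]
          rw [prF_congr hev]
          obtain ⟨t₀, ht₀, hst₀, hget₀⟩ := hE.2 v y hTv
          have hE' : Explains M x n T (acc ++ [y.toList]) := by
            refine explains_snoc M x n hE (fun _ _ h => h) (fun _ _ h => Or.inl h) (fun w hw => ?_)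
            rw [hs, hqv] at hw
            have hwv : v = w := List.Vector.toList_injective (Sum.inl.inj hw)
            subst hwv
            exact ⟨y, hTv, rfl⟩
          have hg' : Good M x n (acc ++ [y.toList]) := by
            refine good_snoc M x n hg fun i hi vi vj hsi hsj hne => ?_
            rw [hs, hqv] at hsj
            have hvj : v = vj := List.Vector.toList_injective (Sum.inl.inj hsj)
            subst hvj
            have h := hg i t₀ vi v hi ht₀ hsi hst₀ hne
            rwa [hget₀] at h
          have h := ih (acc ++ [y.toList]) T hE' hg'
          rw [hlen1] at h
          exact h.trans hmono
        | none =>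
          -- fresh query: lazy sampling over the answer `y`
          have hev : ∀ (y : Block n) (f : Block n → Block n), PTable.Extends (Function.update T v (some y)) f →
              (¬ Good M x n (M.answersAux (oracleOfTable f) x (k + 1) acc) ↔
                ¬ Good M x n (M.answersAux (oracleOfTable f) x k (acc ++ [y.toList]))) := fun y f hf => by
            have hfv : f v = y := ((PTable.extends_update_iff hTv y f).1 hf).2
            rw [answersAux_succ_of_inl hs, oracleOfTable_apply_of_length_eq f hq, ← hvdef, hfv]
          rw [prF_fresh hTv hev]
          set B := badVals M x n acc with hBdef
          set p : Block n → ℝ := fun y => prF (Function.update T v (some y)) fun f =>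
            ¬ Good M x n (M.answersAux (oracleOfTable f) x k (acc ++ [y.toList])) with hpdef
          change (∑ y, p y) / 2 ^ (2 * n) ≤ _
          have hp1 : ∀ y, p y ≤ 1 := fun y => prF_le_one _ _
          have hIH : ∀ y, y ∉ B → p y ≤ IHb := by
            intro y hy
            have hE' : Explains M x n (Function.update T v (some y)) (acc ++ [y.toList]) := by
              refine explains_snoc M x n hE (fun w y' hw => ?_) (fun w y' hw => ?_) (fun w hw => ?_)
              · have hwv : w ≠ v := by rintro rfl; rw [hTv] at hw; exact Option.some_ne_none _ hw.symm
                rw [Function.update_of_ne hwv]; exact hw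
              · by_cases hwv : w = v
                · subst hwv
                  rw [Function.update_self] at hw
                  right
                  exact ⟨hs.trans hqv, by cases hw; rfl⟩
                · left; rwa [Function.update_of_ne hwv] at hw
              · rw [hs, hqv] at hw
                have hwv : v = w := List.Vector.toList_injective (Sum.inl.inj hw)
                subst hwv
                exact ⟨y, Function.update_self _ _ _, rfl⟩
            have hg' : Good M x n (acc ++ [y.toList]) := by
              refine good_snoc M x n hg fun i hi vi vj hsi _ _ heq => hy ?_
              rw [hBdef]
              unfold badVals
              exact mem_filter.2 ⟨mem_univ _, i, hi, vi, hsi, heq⟩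
            have h := ih (acc ++ [y.toList]) (Function.update T v (some y)) hE' hg'
            rw [hlen1] at h
            exact h
          -- split the average along the bad values
          have hBc : (B.card : ℝ) ≤ acc.length * 2 ^ n := by exact_mod_cast card_badVals_le M x n acc
          have hsplit : ∑ y, p y = ∑ y ∈ B, p y + ∑ y ∈ univ \ B, p y := by
            rw [← sum_sdiff (subset_univ B), add_comm]
          have hS1 : ∑ y ∈ B, p y ≤ B.card := by
            calc ∑ y ∈ B, p y ≤ ∑ _y ∈ B, (1 : ℝ) := sum_le_sum fun y _ => hp1 y
              _ = B.card := by simp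
          have hcardle : ((univ \ B).card : ℝ) ≤ 2 ^ (2 * n) := by
            have h : ((univ \ B).card : ℝ) ≤ (Fintype.card (Block n) : ℝ) := by exact_mod_cast card_le_univ _
            rw [card_block] at h
            push_cast at h
            have h22 : ((2 : ℝ) ^ n) ^ 2 = 2 ^ (2 * n) := by rw [← pow_mul, mul_comm]
            rwa [h22] at h
          have hS2 : ∑ y ∈ univ \ B, p y ≤ 2 ^ (2 * n) * IHb := by
            calc ∑ y ∈ univ \ B, p y ≤ ∑ _y ∈ univ \ B, IHb := sum_le_sum fun y hy => hIH y (mem_sdiff.1 hy).2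
              _ = ((univ \ B).card : ℝ) * IHb := by rw [sum_const, nsmul_eq_mul]
              _ ≤ 2 ^ (2 * n) * IHb := mul_le_mul_of_nonneg_right hcardle hIHb_nonneg
          have h2n : (2 : ℝ) ^ (2 * n) = 2 ^ n * 2 ^ n := by rw [two_mul, pow_add]
          have hfinal : (∑ y, p y) / 2 ^ (2 * n) ≤ (acc.length : ℝ) / 2 ^ n + IHb := by
            rw [hsplit, div_le_iff₀ (by positivity)]
            calc ∑ y ∈ B, p y + ∑ y ∈ univ \ B, p y ≤ B.card + 2 ^ (2 * n) * IHb := add_le_add hS1 hS2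
              _ ≤ acc.length * 2 ^ n + 2 ^ (2 * n) * IHb := by linarith
              _ = ((acc.length : ℝ) / 2 ^ n + IHb) * 2 ^ (2 * n) := by
                  rw [h2n]
                  field_simp
          calc (∑ y, p y) / 2 ^ (2 * n) ≤ (acc.length : ℝ) / 2 ^ n + IHb := hfinal
            _ = (((k + 1 : ℕ) : ℝ) * acc.length + ((k + 1 : ℕ) : ℝ) * (((k + 1 : ℕ) : ℝ) - 1) / 2) / 2 ^ n := by
                rw [hIHb]
                push_cast
                field_simp
                ring
      · -- ill-formed query: answered `[]`
        have hev : ∀ f : Block n → Block n,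
            (¬ Good M x n (M.answersAux (oracleOfTable f) x (k + 1) acc) ↔
              ¬ Good M x n (M.answersAux (oracleOfTable f) x k (acc ++ [[]]))) := fun f => by
          rw [answersAux_succ_of_inl hs, oracleOfTable_apply_of_length_ne f hq]
        rw [prF_congr (fun f _ => hev f)]
        have hE' : Explains M x n T (acc ++ [[]]) := by
          refine explains_snoc M x n hE (fun _ _ h => h) (fun _ _ h => Or.inl h) (fun w hw => ?_)
          rw [hs] at hw
          have hqw : q = w.toList := Sum.inl.inj hw
          exact absurd (by rw [hqw, List.Vector.toList_length]) hq
        have hg' : Good M x n (acc ++ [[]]) := by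
          refine good_snoc M x n hg fun i _ vi vj _ hsj _ _ => ?_
          rw [hs] at hsj
          have hqw : q = vj.toList := Sum.inl.inj hsj
          exact absurd (by rw [hqw, List.Vector.toList_length]) hq
        have h := ih (acc ++ [[]]) T hE' hg'
        rw [hlen1] at h
        exact h.trans hmono

/-- **`Pr[ζ] ≤ k(k−1)/2/2ⁿ`**: from the empty transcript, the ideal run within `k` rounds is bad
with probability at most `k(k−1)/(2·2ⁿ)`. [cite: Goldreich2001, Prop. 3.7.8 (p. 205: "`Pr[ζ_m] < m²/2ⁿ`")] -/
theorem finProb_not_good_le (k : ℕ) :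
    finProb (PMF.uniformOfFintype (Block n → Block n))
        (fun h => ¬ Good M x n (M.answers (oracleOfTable h) k x)) ≤
      (k : ℝ) * ((k : ℝ) - 1) / 2 / 2 ^ n := by
  classical
  have hE : Explains M x n (fun _ => none) [] :=
    ⟨fun t ht => absurd ht (by simp), fun v y h => (Option.some_ne_none _ h.symm).elim⟩
  have hg : Good M x n [] := fun i j vi vj hi => absurd hi (by simp)
  have h := prF_not_good_le M x n k [] (fun _ => none) hE hg
  simp only [List.length_nil, Nat.cast_zero, mul_zero, zero_add] at h
  rw [prF_bot_eq, ← finProb_uniform] at h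
  exact h

end Bad

/-! ### Prop. 3.7.8: the main lemma -/

section Main

open OracleAlgTranscript

/-- **(a) `DES³_{H_n}` versus a uniformly random function on `{0,1}²ⁿ`** (coefficient H with the
good transcripts of Prop. 3.7.8): for every transcript property, the two worlds differ by at most
`k(k−1)/2ⁿ + k(k−1)/(2·2ⁿ)`. [cite: Goldreich2001, Prop. 3.7.8 (pp. 203–205)] [cite: Patarin2009, Thm. 3 (p. 329)] -/
theorem abs_finProb_feistel_sub_function_le (M : OracleAlg β) (x : List Bool) (k n : ℕ)
    (P : List (List Bool) → Prop) :
    |finProb (PMF.uniformOfFintype (RoundTables n)) (fun H => P (M.answers (oracleOfTable (table H)) k x)) -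
        finProb (PMF.uniformOfFintype (Block n → Block n)) (fun h => P (M.answers (oracleOfTable h) k x))| ≤
      (k : ℝ) * ((k : ℝ) - 1) / 2 ^ n + (k : ℝ) * ((k : ℝ) - 1) / 2 / 2 ^ n :=
  M.hcoeff_abs_le k x (PMF.uniformOfFintype (RoundTables n)) (fun H => oracleOfTable (table H))
    (PMF.uniformOfFintype (Block n → Block n)) (fun h => oracleOfTable h) P (Good M x n)
    (div_nonneg (cast_mul_pred_nonneg k) (by positivity))
    (fun h₀ hgood => hratio_feistel M x n k h₀ hgood) (finProb_not_good_le M x n k)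

/-- **(b) A uniformly random function versus a uniformly random permutation of `{0,1}²ⁿ`** (the
switching lemma of `PRPSwitchingLemma.lean`, in `finProb` form): at most `k(k−1)/(2·2²ⁿ)`.
[cite: Goldreich2001, Prop. 3.7.3 (p. 201)] -/
theorem abs_finProb_function_sub_perm_le (M : OracleAlg β) (x : List Bool) (k n : ℕ) (S : Set (Option β)) :
    |finProb (PMF.uniformOfFintype (Block n → Block n)) (fun h => M.run (oracleOfTable h) k x ∈ S) -
        finProb (PMF.uniformOfFintype (Equiv.Perm (Block n))) (fun σ => M.run (oracleOfTable σ) k x ∈ S)| ≤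
      (k : ℝ) * ((k : ℝ) - 1) / 2 / 2 ^ (2 * n) := by
  classical
  have hτ : PTable.IsInj (a := 2 * n) (fun _ => none) := fun v w y hv _ =>
    (Option.some_ne_none _ hv.symm).elim
  have h := abs_prF_sub_prP_le M x S k [] (fun _ => none) hτ
  have hrng : (PTable.rng (a := 2 * n) fun _ => none) = ∅ := by
    ext y; simp [PTable.rng]
  rw [hrng, Finset.card_empty, Nat.cast_zero, mul_zero, zero_add] at h
  rw [prF_bot_eq, prP_bot_eq, ← finProb_uniform, ← finProb_uniform] at h
  exact h

/-- **Discharge of `LubyRackoff.MainLemma` — Luby–Rackoff's main lemma / Goldreich's Prop. 3.7.8,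
eq. (3.17)**: for every deterministic oracle algorithm with round budget `k`, input `x` and output
event `S`, `|Pr_H[M^{DES³_H}(x) ∈ S] − Pr_σ[M^σ(x) ∈ S]| ≤ 2k²/2ⁿ`. Proof: triangle inequality
through the uniformly random function on `{0,1}²ⁿ`; (a) Patarin's coefficient-H bound
(`OracleAlg.hcoeff_abs_le`) with good transcripts = "answers at distinct queries have distinct left
halves" (`¬ζ`), ratio `≥ 1 − k(k−1)/2ⁿ` by counting the round functions (Claim 3.7.8.1:
`core_ratio`) and bad event `≤ k(k−1)/(2·2ⁿ)` by lazy sampling (Claim 3.7.8.2: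
`finProb_not_good_le`); (b) the PRP/PRF switching lemma (`abs_prF_sub_prP_le`); total
`2k(k−1)/2ⁿ ≤ 2k²/2ⁿ`. [cite: Goldreich2001, Prop. 3.7.8, eq. (3.17) (pp. 203–205)]
[cite: LubyRackoff1988, abstract (main result)] [cite: Patarin2009, Thm. 3 (p. 329)] -/
theorem MainLemma_holds : MainLemma := by
  intro β M x k n S
  classical
  have eX : ((PMF.uniformOfFintype (RoundTables n)).toOuterMeasure
      {H | M.run (oracleOfTable (table H)) k x ∈ S}).toReal =
      finProb (PMF.uniformOfFintype (RoundTables n)) (fun H => M.run (oracleOfTable (table H)) k x ∈ S) :=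
    toReal_toOuterMeasure_eq_finProb _ _
  have eP : ((PMF.uniformOfFintype (Equiv.Perm (List.Vector Bool (2 * n)))).toOuterMeasure
      {σ | M.run (oracleOfTable σ) k x ∈ S}).toReal =
      finProb (PMF.uniformOfFintype (Equiv.Perm (Block n))) (fun σ => M.run (oracleOfTable σ) k x ∈ S) :=
    toReal_toOuterMeasure_eq_finProb _ _
  rw [eX, eP]
  have h1 : |finProb (PMF.uniformOfFintype (RoundTables n)) (fun H => M.run (oracleOfTable (table H)) k x ∈ S) -
      finProb (PMF.uniformOfFintype (Block n → Block n)) (fun h => M.run (oracleOfTable h) k x ∈ S)| ≤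
      (k : ℝ) * ((k : ℝ) - 1) / 2 ^ n + (k : ℝ) * ((k : ℝ) - 1) / 2 / 2 ^ n := by
    have h := abs_finProb_feistel_sub_function_le M x k n (fun τ => M.finish x k τ ∈ S)
    simpa only [← OracleAlg.run_eq_finish_answers] using h
  have h2 := abs_finProb_function_sub_perm_le M x k n S
  have hk := cast_mul_pred_nonneg k
  have h3 : (k : ℝ) * ((k : ℝ) - 1) / 2 / 2 ^ (2 * n) ≤ (k : ℝ) * ((k : ℝ) - 1) / 2 / 2 ^ n :=
    div_le_div_of_nonneg_left (by positivity) (by positivity)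
      (pow_le_pow_right₀ (by norm_num) (by omega))
  calc |finProb (PMF.uniformOfFintype (RoundTables n)) (fun H => M.run (oracleOfTable (table H)) k x ∈ S) -
        finProb (PMF.uniformOfFintype (Equiv.Perm (Block n))) (fun σ => M.run (oracleOfTable σ) k x ∈ S)|
      = |(finProb (PMF.uniformOfFintype (RoundTables n)) (fun H => M.run (oracleOfTable (table H)) k x ∈ S) -
            finProb (PMF.uniformOfFintype (Block n → Block n)) (fun h => M.run (oracleOfTable h) k x ∈ S)) +
          (finProb (PMF.uniformOfFintype (Block n → Block n)) (fun h => M.run (oracleOfTable h) k x ∈ S) -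
            finProb (PMF.uniformOfFintype (Equiv.Perm (Block n))) (fun σ => M.run (oracleOfTable σ) k x ∈ S))| := by
        ring_nf
    _ ≤ _ := abs_add_le _ _
    _ ≤ ((k : ℝ) * ((k : ℝ) - 1) / 2 ^ n + (k : ℝ) * ((k : ℝ) - 1) / 2 / 2 ^ n) +
          (k : ℝ) * ((k : ℝ) - 1) / 2 / 2 ^ n := add_le_add h1 (h2.trans h3)
    _ = 2 * ((k : ℝ) * ((k : ℝ) - 1)) / 2 ^ n := by ring
    _ ≤ 2 * (k : ℝ) ^ 2 / 2 ^ n := by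
        apply div_le_div_of_nonneg_right _ (by positivity)
        nlinarith [(Nat.cast_nonneg k : (0 : ℝ) ≤ k)]

end Main

end LubyRackoff

end Literature.Computability.Cryptography
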